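import Literature.MathematicalPhysics.QuantumFieldTheory.Balaban1983to89.B9Eq325QGGQCoerciveCompactZd

/-!
# `Balaban1983to89.B9Thm311InverseL2BoundsZd` — [Balaban1985BackgroundPropagators] THM 3.11 p. 416 ∕ THM 3.1 (3.42) p. 397 ∕ (3.25) p. 394 and [Balaban1984PropagatorsII] (2.22) p. 226
# («bounded from below by a positive constant, hence … G = Δ_a⁻¹», `‖G‖ ≤ γ⁻¹`) AT THE `ℤᵈ × 𝔸` CARRIER: THE TWO «OBVIOUS» INVERSES `G′(U₀) = (Ω₀Δ′_aΩ₀)⁻¹` AND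
# `(Q′G′(U₀)²Q′*)⁻¹` ARE BOUNDED IN `L²_τ` BY THE INVERSE OF THEIR COERCIVITY CONSTANTS — `‖G′(U₀)f‖_τ ≤ c′⁻¹‖f‖_τ`, `‖(Q′G′²Q′*)⁻¹φ‖_τ ≤ c″⁻¹‖φ‖_τ` — with ONE constant over
# the closed class (1.7) on `ℤᵈ` (the `n = 0` ∕ no-decay content of (3.42) for the first two operators of Thm 3.11, companion of this seat's `B9Thm33GreenL2BoundCubeZd` for `G_𝔤`)

statement-level skeleton of published theorems with citation tags; proofs where landed; nothing here is a claim about the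
Yang–Mills mass gap

`[Balaban1985BackgroundPropagators]` ("B9", CMP **99** (1985) 389–434) p. 394 (3.24)–(3.25), p. 397 Thm 3.1 ((3.42) for `G′`), p. 416 Thm 3.11; `[Balaban1984PropagatorsII]`
("[4]", CMP **96**) p. 226, (2.22).  The «hence» of [4] p. 226 as a two-line abstract lemma (Cauchy–Schwarz for a non-negative symmetric form + a lower form bound ⟹ the
inverse is bounded), instantiated for g2's objects `GpZd` and `cZd` with the constants of `B9Thm31CoercivePrimeCompactZd` ∕ `B9Eq325QGGQCoerciveCompactZd`.  PDF held:
`paper:balaban1985-cmp99-background-propagators` pp. 394–397, 416 (re-read by this seat, 2026-08-28).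

CITATION HEADER (lean-in-tree rule).  Cell `pub-ymgap` (YM Track A, D-0062 ∕ D-0149), node N06 = [B9], width seat `pub-ymgap-dag-n06-w4` (g4), CLAIM-8 ∕ INTENT-8.
Inputs BY NAME: this seat's g2 `B9Eq324DeltaPrimeAZd` (`GpZd`, `deltaPrimeADom_GpZd`), `B9Eq325QGGQInvZd` (`cZd`, `qggq_cZd`, `levForm`, `levForm_self_nonneg`), g0
`B9Eq321LandauProjectionZd` (`formE`, `formE_isSymm`), `B9Eq316AveragingTransposeZd.tauForm_isSymm`, g4 `B9Thm31CoercivePrimeCompactZd.exists_coercive_formE_deltaPrimeADom_plaqClosed`,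
g4 `B9Eq325QGGQCoerciveCompactZd.exists_coercive_levForm_qggq_plaqClosed_cubeMember`.

WHAT IS PROVED (kernel, 0 sorry; theorems only — no `def`, `instance`, `notation`).
* §1 (`[folklore]` linear algebra, any real vector space) ★ `sq_le_mul_of_symm_nonneg` (CAUCHY–SCHWARZ for a non-negative symmetric bilinear form, by the discriminant),
  ★★ `self_le_of_lower_bound` («bounded from below ⟹ the inverse is bounded»: `c·B(y,y) ≤ B(y,x)`, `c > 0` ⟹ `B(y,y) ≤ c⁻²·B(x,x)`).
* §2 (`G′`, generic `Ω₀ = s`, `m`, `a ≥ 0`, `Λ`; every unitary `U₀`) `formE_self_nonneg'`, ★★ `formE_GpZd_self_le_of_coercive` (`hco` of STATION 1's shape ⟹ `⟨G′f, G′f⟩_τ ≤ c⁻²⟨f,f⟩_τ`),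
  ★★★ `exists_formE_GpZd_self_le_plaqClosed` (ONE `c′` over the closed class (1.7) on `ℤᵈ`: `‖G′(U₀)f‖²_τ ≤ c′⁻²‖f‖²_τ`).
* §3 (`(Q′G′²Q′*)⁻¹`) `levForm_comm`, ★★ `levForm_cZd_self_le_of_coercive` (`hco` of STATION 2's shape ⟹ `⟨cφ, cφ⟩_τ ≤ c⁻²⟨φ,φ⟩_τ`),
  ★★★ `exists_levForm_cZd_self_le_plaqClosed_cubeMember` (ONE `c″` over the closed class at a cube member, «Q′ onto» discharged by name).

HONEST SCOPE.  `L²_τ → L²_τ` bounds ONLY (no kernel decay — that is dag-n06-w2 g4's STATION 1∕2 road); constants NON-QUANTITATIVE (compactness); `τ` a PARAMETER; count-neutral helper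
(`--supports` the K1 item of record); N05 ∕ N06 NOT discharged; K1 NOT closed; one finite `𝕋⁴` programme at fixed `ε`, Bałaban as printed; R4 closes only the conditional finite-`𝕋⁴`
rung `BalabanLadder.UV` — nothing continuum ∕ ℝ⁴ ∕ OS ∕ mass gap ∕ Clay.  Unit `pub-ymgap-dag-n06-w4` (g4), 2026-08-28.
-/

noncomputable section

namespace Literature.MathematicalPhysics.QuantumFieldTheory.Balaban1983to89.B9Thm311InverseL2BoundsZd

open Filter Topology
open B7Prop1Explicit
open B7Prop2Explicit (unitaryUnits)
open B8Ineq132 (plaqF)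
open B8Eq131CubesAdmissible (cubeFam)
open B8CubeMemberZd (cubeLamS)
open B8LeafModelZd (ZdIdx)
open B8Eq191FlatLettersCubeMember (cubeLamS_finite)
open B9Eq316AveragingTransposeZd (Reg17 alphaQ alphaQ_pos tauForm tauForm_apply tauForm_isSymm)
open B9Eq321LandauProjectionZd (suppSub formE formE_apply formE_isSymm)
open B9Eq324DeltaPrimeAZd (deltaPrimeADom GpZd deltaPrimeADom_GpZd)
open B9Eq325QGGQInvZd (levSupp levForm levForm_apply qggq cZd qggq_cZd levForm_self_nonneg QprimeStarInjective)
open B9Thm311PosDefOpenZd (cubeMember_Ω0_finite)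
open B9Thm311PosDefNearFlatZd (qprimeStarInjective_cubeMember)
open B9Thm31CoercivePrimeCompactZd (exists_coercive_formE_deltaPrimeADom_plaqClosed)
open B9Eq325QGGQCoerciveCompactZd (exists_coercive_levForm_qggq_plaqClosed_cubeMember)

export B7Prop1Explicit (Site)

/-! ## §1  Linear algebra: Cauchy–Schwarz for a non-negative symmetric form; lower bound ⟹ bounded inverse -/

section Abstract

variable {V : Type*} [AddCommGroup V] [Module ℝ V]

/-- ★ **CAUCHY–SCHWARZ FOR A NON-NEGATIVE SYMMETRIC BILINEAR FORM**: `B(v, w)² ≤ B(v, v)·B(w, w)` (the discriminant of `t ↦ B(v − tw, v − tw) ≥ 0`).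
[cite: Balaban1985BackgroundPropagators, p.391 («X·Y = tr XY» — the printed scalar products; Cauchy–Schwarz, folklore)] -/
theorem sq_le_mul_of_symm_nonneg (B : V →ₗ[ℝ] V →ₗ[ℝ] ℝ) (hsymm : ∀ v w : V, B v w = B w v) (hnn : ∀ v : V, 0 ≤ B v v) (v w : V) :
    (B v w) ^ 2 ≤ B v v * B w w := by
  have hquad : ∀ t : ℝ, 0 ≤ B w w * (t * t) + (-2 * B v w) * t + B v v := by
    intro t
    have h0 := hnn (v - t • w)
    have hexp : B (v - t • w) (v - t • w) = B w w * (t * t) + (-2 * B v w) * t + B v v := by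
      simp only [map_sub, map_smul, LinearMap.sub_apply, LinearMap.smul_apply, smul_eq_mul]
      rw [hsymm w v]
      ring
    rw [hexp] at h0
    exact h0
  have hdisc := discrim_le_zero hquad
  rw [discrim] at hdisc
  nlinarith [hdisc]

/-- ★★ **«BOUNDED FROM BELOW BY A POSITIVE CONSTANT, HENCE THE INVERSE IS BOUNDED»** ([4] p. 226, (2.22), abstractly): for a non-negative symmetric form `B`, if
`c·B(y, y) ≤ B(y, x)` with `c > 0` (coercivity of an operator `T` at `y` with `Ty = x`), then `B(y, y) ≤ c⁻²·B(x, x)`.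
[cite: Balaban1984PropagatorsII, p.226, (2.22); Balaban1985BackgroundPropagators, Thm 3.11 p.416] -/
theorem self_le_of_lower_bound (B : V →ₗ[ℝ] V →ₗ[ℝ] ℝ) (hsymm : ∀ v w : V, B v w = B w v) (hnn : ∀ v : V, 0 ≤ B v v) {c : ℝ} (hc : 0 < c)
    {x y : V} (h : c * B y y ≤ B y x) : B y y ≤ c⁻¹ ^ 2 * B x x := by
  have hCS := sq_le_mul_of_symm_nonneg B hsymm hnn y x
  have hyy := hnn y
  have hxx := hnn x
  have hc2 : 0 < c ^ 2 := by positivity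
  have key : c ^ 2 * B y y ≤ B x x := by
    by_cases h0 : B y y = 0
    · rw [h0, mul_zero]; exact hxx
    · have hpos : 0 < B y y := lt_of_le_of_ne hyy (Ne.symm h0)
      have h1 : (c * B y y) ^ 2 ≤ B y y * B x x := by
        calc (c * B y y) ^ 2 ≤ (B y x) ^ 2 := pow_le_pow_left₀ (by positivity) h 2
          _ ≤ B y y * B x x := hCS
      have h2 : c ^ 2 * B y y * B y y ≤ B x x * B y y := by nlinarith [h1]
      exact le_of_mul_le_mul_right h2 hpos
  rw [inv_pow, ← div_eq_inv_mul, le_div_iff₀ hc2]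
  linarith [key]

end Abstract

/-! ## §2  `G′(U₀)` is bounded in `L²_τ` by the inverse coercivity constant of `Ω₀Δ′_a(U₀)Ω₀` -/

section GreenPrime

variable {d : ℕ} {𝔸 : Type*} [CStarAlgebra 𝔸] [FiniteDimensional ℝ 𝔸] [Nontrivial 𝔸]
variable (τ : 𝔸 →ₗ[ℂ] ℂ) (hτp : ∀ a : 𝔸, a ≠ 0 → 0 < (τ (star a * a)).re) {L : ℕ} {η : ℝ}
  (hτt : ∀ a b : 𝔸, τ (a * b) = τ (b * a)) (hτs : ∀ a : 𝔸, τ (star a) = starRingEnd ℂ (τ a))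

omit [FiniteDimensional ℝ 𝔸] [Nontrivial 𝔸] in
include hτp in
/-- `⟨f, f⟩_τ ≥ 0` on `L²(Ω₀, ·)` (faithful `τ`). [cite: Balaban1985BackgroundPropagators, (3.21) p.394, p.390 («|X|² = tr X*X»)] -/
theorem formE_self_nonneg' (s : Finset (Site d)) (f : suppSub (𝔸 := 𝔸) s) : 0 ≤ formE τ s f f := by
  rw [formE_apply]
  refine Finset.sum_nonneg fun x _ => ?_
  by_cases h : (f : Site d → 𝔸) x = 0
  · rw [h, mul_zero, map_zero, Complex.zero_re]
  · exact (hτp _ h).le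

omit [Nontrivial 𝔸] in
include hτp in
/-- ★★ **(3.42) AT `n = 0` FOR `G′(U₀)`, FROM A COERCIVITY CONSTANT**: `c·⟨g, g⟩_τ ≤ ⟨g, Ω₀Δ′_a(U₀)Ω₀ g⟩_τ` for all `g` (STATION 1's `hco`) ⟹ `⟨G′f, G′f⟩_τ ≤ c⁻²·⟨f, f⟩_τ`
for every `f ∈ L²(Ω₀, ·)` — every unitary `U₀`, `a ≥ 0`, `0 < d`, `η ≠ 0`, Hermitian faithful `τ`.
[cite: Balaban1985BackgroundPropagators, Thm 3.1 p.397, (3.42) p.397, (3.24) p.394; Balaban1984PropagatorsII, (2.22) p.226] -/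
theorem formE_GpZd_self_le_of_coercive (hd : 0 < d) (hη : η ≠ 0) (m : ℕ) {a : ℕ → ℝ} (ha : ∀ j, 0 ≤ a j) (Λ : ℕ → Finset (Site d)) (s : Finset (Site d))
    {U₀ : Site d → Fin d → 𝔸ˣ} (hU : ∀ (x : Site d) (κ : Fin d), U₀ x κ ∈ unitaryUnits 𝔸) {c : ℝ} (hc : 0 < c)
    (hco : ∀ g : suppSub (𝔸 := 𝔸) s, c * formE τ s g g ≤ formE τ s g (deltaPrimeADom L U₀ η τ hτp m a Λ s g)) (f : suppSub (𝔸 := 𝔸) s) :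
    formE τ s (GpZd L U₀ η τ hτp m a Λ s hd hη hτt hτs hU ha f) (GpZd L U₀ η τ hτp m a Λ s hd hη hτt hτs hU ha f) ≤ c⁻¹ ^ 2 * formE τ s f f := by
  set g := GpZd L U₀ η τ hτp m a Λ s hd hη hτt hτs hU ha f with hg
  have h := hco g
  rw [hg, deltaPrimeADom_GpZd hd hη hτt hτs hU ha f] at h
  exact self_le_of_lower_bound (formE τ s) (fun v w => (formE_isSymm τ s hτs).eq v w) (formE_self_nonneg' τ hτp s) hc h

include hτp hτt hτs in
/-- ★★★ **ONE `L²_τ` BOUND FOR `G′(U₀)` OVER THE CLOSED CLASS (1.7) ON `ℤᵈ`**: for every `β < (α_Q∕L²)·L^{−2m}` there is `c′ > 0` with `⟨G′(U₀)f, G′(U₀)f⟩_τ ≤ c′⁻²·⟨f, f⟩_τ` for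
EVERY unitary `U₀` whose plaquettes are all within `β` of `1` and every `f ∈ L²(Ω₀, ·)` (generic `Ω₀ = s`, `m`, `a ≥ 0`, `Λ`; `0 < d`, `2 ≤ L`, `η ≠ 0`).
[cite: Balaban1985BackgroundPropagators, Thm 3.1 p.397, Thm 3.11 p.416, (3.35) p.396; Balaban1985RegularSpaces, (1.7) p.77] -/
theorem exists_formE_GpZd_self_le_plaqClosed (hd : 0 < d) (hL : 2 ≤ L) (hη : η ≠ 0) (m : ℕ) {a : ℕ → ℝ} (ha : ∀ j, 0 ≤ a j)
    (Λ : ℕ → Finset (Site d)) (s : Finset (Site d)) {β : ℝ} (hβ : β < alphaQ d L / (L : ℝ) ^ 2 * (((L : ℝ) ^ m)⁻¹) ^ 2) :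
    ∃ c : ℝ, 0 < c ∧ ∀ (U₀ : Site d → Fin d → 𝔸ˣ) (hU₀ : ∀ x κ, U₀ x κ ∈ unitaryUnits 𝔸),
      (∀ (x : Site d) (μ ν : Fin d), ‖plaqF U₀ μ ν x - 1‖ ≤ β) → ∀ f : suppSub (𝔸 := 𝔸) s,
        formE τ s (GpZd L U₀ η τ hτp m a Λ s hd hη hτt hτs hU₀ ha f) (GpZd L U₀ η τ hτp m a Λ s hd hη hτt hτs hU₀ ha f) ≤ c⁻¹ ^ 2 * formE τ s f f := by
  obtain ⟨c, hc, h⟩ := exists_coercive_formE_deltaPrimeADom_plaqClosed τ hτp hτt hτs hd hL hη m ha Λ s hβ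
  exact ⟨c, hc, fun U₀ hU₀ hplaq f => formE_GpZd_self_le_of_coercive τ hτp hτt hτs hd hη m ha Λ s hU₀ hc (h U₀ hU₀ hplaq) f⟩

end GreenPrime

/-! ## §3  `(Q′G′(U₀)²Q′*)⁻¹` is bounded in `L²_τ` by the inverse coercivity constant of `Q′G′²Q′*` -/

section CInverse

variable {d : ℕ} {𝔸 : Type*} [CStarAlgebra 𝔸] [FiniteDimensional ℝ 𝔸] [Nontrivial 𝔸]
variable (τ : 𝔸 →ₗ[ℂ] ℂ) (hτp : ∀ a : 𝔸, a ≠ 0 → 0 < (τ (star a * a)).re) {L : ℕ} {η : ℝ}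
  (hτt : ∀ a b : 𝔸, τ (a * b) = τ (b * a)) (hτs : ∀ a : 𝔸, τ (star a) = starRingEnd ℂ (τ a))

omit [FiniteDimensional ℝ 𝔸] [Nontrivial 𝔸] in
include hτs in
/-- the level pairing is symmetric (Hermitian `τ`). [cite: Balaban1985BackgroundPropagators, (3.24) p.394, p.391] -/
theorem levForm_comm (m : ℕ) (Λ : ℕ → Finset (Site d)) (φ ψ : levSupp (𝔸 := 𝔸) m Λ) : levForm τ m Λ φ ψ = levForm τ m Λ ψ φ := by
  rw [levForm_apply, levForm_apply]
  refine Finset.sum_congr rfl fun j _ => Finset.sum_congr rfl fun y _ => ?_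
  have h := (tauForm_isSymm τ hτs).eq ((φ : ℕ × Site d → 𝔸) (j, y)) ((ψ : ℕ × Site d → 𝔸) (j, y))
  rwa [tauForm_apply, tauForm_apply] at h

omit [Nontrivial 𝔸] in
include hτp in
/-- ★★ **(3.42) AT `n = 0` FOR `(Q′G′²Q′*)⁻¹`, FROM A COERCIVITY CONSTANT**: `c·⟨ψ, ψ⟩_τ ≤ ⟨ψ, Q′G′²Q′*ψ⟩_τ` for all `ψ` (STATION 2's `hco`) ⟹
`⟨cφ, cφ⟩_τ ≤ c⁻²·⟨φ, φ⟩_τ` for every `φ ∈ L²(𝔅, ·)` (`Q′*` injective at `U₀`).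
[cite: Balaban1985BackgroundPropagators, (3.25) p.394, Thm 3.11 p.416; Balaban1984PropagatorsII, (2.22) p.226] -/
theorem levForm_cZd_self_le_of_coercive (hd : 0 < d) (hη : η ≠ 0) (m : ℕ) {a : ℕ → ℝ} (ha : ∀ j, 0 ≤ a j) (Λ : ℕ → Finset (Site d)) (s : Finset (Site d))
    {U₀ : Site d → Fin d → 𝔸ˣ} (hU : ∀ (x : Site d) (κ : Fin d), U₀ x κ ∈ unitaryUnits 𝔸) (hinj : QprimeStarInjective L U₀ τ hτp m Λ s) {c : ℝ} (hc : 0 < c)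
    (hco : ∀ ψ : levSupp (𝔸 := 𝔸) m Λ, c * levForm τ m Λ ψ ψ ≤ levForm τ m Λ ψ (qggq L U₀ η τ hτp m a Λ s hd hη hτt hτs hU ha ψ))
    (φ : levSupp (𝔸 := 𝔸) m Λ) :
    levForm τ m Λ (cZd L U₀ η τ hτp m a Λ s hd hη hτt hτs hU ha hinj φ) (cZd L U₀ η τ hτp m a Λ s hd hη hτt hτs hU ha hinj φ) ≤
      c⁻¹ ^ 2 * levForm τ m Λ φ φ := by
  set ψ := cZd L U₀ η τ hτp m a Λ s hd hη hτt hτs hU ha hinj φ with hψ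
  have h := hco ψ
  rw [hψ, qggq_cZd] at h
  exact self_le_of_lower_bound (levForm τ m Λ) (levForm_comm τ hτs m Λ) (levForm_self_nonneg τ m Λ hτp) hc h

include hτp hτt hτs in
/-- ★★★ **ONE `L²_τ` BOUND FOR `(Q′G′(U₀)²Q′*)⁻¹` OVER THE CLOSED CLASS AT A CUBE MEMBER** (`Λ_j` = the level-`j` constraint sites `cubeLamS`, `s = □₀`; «Q′ onto» by name):
for every `β < (α_Q∕L²)·L^{−2m}` there is `c″ > 0` with `⟨cφ, cφ⟩_τ ≤ c″⁻²·⟨φ, φ⟩_τ` for EVERY unitary `U₀` whose plaquettes are all within `β` of `1`, every `φ`.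
[cite: Balaban1985BackgroundPropagators, (3.25) p.394, Thm 3.11 p.416; Balaban1985RegularSpaces, (1.7) p.77, (1.131) p.99] -/
theorem exists_levForm_cZd_self_le_plaqClosed_cubeMember [NeZero L] (hd : 0 < d) (hL : 2 ≤ L) {a₀ : ℕ → ℝ} (ha : ∀ j, 0 ≤ a₀ j)
    (i : ZdIdx d L) (hη : i.η ≠ 0) {a : Site d} {Mc ρ : ℕ} (hΩ : i.Ω = cubeFam false L a Mc ρ i.k) (hρ : L ≤ ρ) {m : ℕ} (hm : m ≤ i.k)
    {β : ℝ} (hβ : β < alphaQ d L / (L : ℝ) ^ 2 * (((L : ℝ) ^ m)⁻¹) ^ 2) :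
    ∃ c : ℝ, 0 < c ∧ ∀ (U₀ : Site d → Fin d → 𝔸ˣ) (hU₀ : ∀ x κ, U₀ x κ ∈ unitaryUnits 𝔸),
      (∀ (x : Site d) (μ ν : Fin d), ‖plaqF U₀ μ ν x - 1‖ ≤ β) →
        ∀ φ : levSupp (𝔸 := 𝔸) m (fun j => (cubeLamS_finite L a Mc ρ i.k m j).toFinset),
          levForm τ m (fun j => (cubeLamS_finite L a Mc ρ i.k m j).toFinset)
              (cZd L U₀ i.η τ hτp m a₀ (fun j => (cubeLamS_finite L a Mc ρ i.k m j).toFinset) (cubeMember_Ω0_finite i hΩ).toFinset hd hη hτt hτs hU₀ ha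
                (qprimeStarInjective_cubeMember τ hτp hτs i hΩ hρ hm U₀) φ)
              (cZd L U₀ i.η τ hτp m a₀ (fun j => (cubeLamS_finite L a Mc ρ i.k m j).toFinset) (cubeMember_Ω0_finite i hΩ).toFinset hd hη hτt hτs hU₀ ha
                (qprimeStarInjective_cubeMember τ hτp hτs i hΩ hρ hm U₀) φ) ≤
            c⁻¹ ^ 2 * levForm τ m (fun j => (cubeLamS_finite L a Mc ρ i.k m j).toFinset) φ φ := by
  obtain ⟨c, hc, h⟩ := exists_coercive_levForm_qggq_plaqClosed_cubeMember τ hτp hτt hτs hd hL ha i hη hΩ hρ hm hβ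
  exact ⟨c, hc, fun U₀ hU₀ hplaq φ => levForm_cZd_self_le_of_coercive τ hτp hτt hτs hd hη m ha _ _ hU₀ _ hc (h U₀ hU₀ hplaq) φ⟩

end CInverse

end Literature.MathematicalPhysics.QuantumFieldTheory.Balaban1983to89.B9Thm311InverseL2BoundsZd

end
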